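import Summits.ValiantsHypothesis.ValiantsHypothesis.Theses.RyserTripartition
import Literature.Computability.AlgebraicComplexity.ArithCircuitProofs

/-!
# Birth skeleton (BC3) for crux `RyserTripartition.RyserOptimal` (stmt-ValiantsHypothesis-7159)

Route `route-ValiantsHypothesis-RyserTripartition`, crux rank 0 (the route's target, auto-crux since
2026-08-16: it is the one load-bearing hypothesis of the route's deciding theorem `closes`); route decl
`Summit.ValiantsHypothesis.ValiantsHypothesis.Theses.RyserTripartition.RyserOptimal`:
for every `ε > 0` and all large `n`, `2^((1-ε) n) ≤ L(per_n)`, `L = complexity` the fan-in-two circuit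
complexity over `ℂ` (Ryser/Glynn give `O(n 2^n)`).

## Line `birth` — the multilinear rung carries the exponent: Ryser-optimality for syntactically
## multilinear circuits + multilinearisation of permanent circuits at sub-exponential cost

The route's thesis already says where the exponent question lives ("already at the multilinear rung":
the bridge `PerLeTripartition` and `HostageGlue` show that even MULTILINEAR Ryser-optimality forces the
general-circuit bound `C(T_k) ≥ 8^(k-o(k))` for Pratt's tripartition form).  This skeleton records the
converse bookkeeping exactly: the crux X = `RyserOptimal` is EQUIVALENT (given Ryser's syntactically
multilinear `n 2^n` formula) to the conjunction of three strictly weaker statements, each implied by X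
and none implying X or `ValiantsHypothesis` on its own —

* **Stub R `stub_multilinearRyser`** (OPEN — the lower-bound heart) = the route's own rank-3 crux
  `MultilinearRyserOptimal` (item stmt-ValiantsHypothesis-11285) BY NAME: every fan-in-two
  SYNTACTICALLY MULTILINEAR circuit computing `per_n` has `≥ 2^((1-ε) n)` gates for large `n`.  This is
  Ryser-optimality in the one model with a lower-bound technology of its own (partial-derivative matrix
  under random partitions: Raz 2004/2009, Raz–Yehudayoff 2008/2011, Raz–Shpilka–Yehudayoff 2008
  `Ω(n^{4/3}/log² n)`, Alon–Kumar–Volk 2020 `Ω(n²/log² n)`), far below `2^n` (barrier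
  `Literature.Barriers.ValiantsHypothesis.FullRankMultilinear`: the full-rank method stops at `n³`).
  It is also where the route's ARC-tension sits: `PerLeTripartition → MultilinearRyserOptimal →
  TripartitionHard` (`HostageGlue`), and in the tree `not_ryserOptimal_of_minimalAsymptoticRank`
  (BKKN 2025 Thm 1.3 + 3.3 as named facts) records ARC|_{P_ℕ} ⇒ ¬RyserOptimal.
* **Stub S `stub_semanticMultilinearization`** (OPEN) — HIGH POWERS DO NOT HELP THE PERMANENT BY AN
  EXPONENTIAL FACTOR: for every `ε > 0` and large `n`, every fan-in-two circuit `Γ` computing `per_n`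
  can be replaced by a fan-in-two MULTILINEAR circuit (every gate value has degree `≤ 1` in each
  variable; Raz–Yehudayoff's "multilinear circuit") computing `per_n` with `≤ 2^(ε n) · |Γ|` gates.
  Generic multilinear projection of a circuit is VNP-hard (the multilinear part of a product of affine
  forms is a permanent), and the row-set-multilinear projection `π_A`, `A ⊆ rows`, costs `3^n · |Γ|`
  (exact, but the wrong base); the statement asks base `2^(o(n))` for circuits that already OUTPUT
  `per_n`.  Why it might fail: its determinant twin is plausibly false (`det_n ∈ VP` by
  NON-multilinear circuits — powers, traces, clow sequences — while the smallest known formulas and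
  circuits for `det_n` are not multilinear, Landsberg 2017 §7.4.4, and no `2^(o(n))` multilinear circuit
  for `det_n` is in print to my search), so no per/det-agnostic argument proves S; and "a single minus
  gate adds a lot of power" (Valiant 1980) is the standing warning against the intuition "multilinear
  targets want multilinear computation".
* **Stub T `stub_syntacticMultilinearization`** (OPEN) — SEMANTIC = SYNTACTIC FOR PERMANENT CIRCUITS
  UP TO `2^(o(n))`: a fan-in-two multilinear circuit computing `per_n` can be made SYNTACTICALLY
  multilinear (`IsSyntacticallyMultilinear`: product gates multiply operands with disjoint syntactic
  variable sets) at cost `≤ 2^(ε n) · |Γ|`.  For FORMULAS this is free (Raz: substitute `x := 0` in the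
  child not depending on `x`); for circuits a gate is shared by many parents wanting different
  substitutions, and the efficient simulation of multilinear by syntactically multilinear circuits is
  the open question flagged by Raz–Shpilka–Yehudayoff 2008 / Raz–Yehudayoff 2011 §1.  Why it might
  fail: a multilinear-but-not-syntactic circuit family for `per_n` of size `(2-δ)^n` whose
  syntactification provably costs `(1+δ')^n` — nothing of the kind is known in either direction.

Composition `RyserOptimal_of` (sorry-free): given `ε`, run S, T, R at `ε/3`: an optimal circuit `Γ`
(`ArithCircuit.exists_computes_size_eq_complexity`, `|Γ| = L(per_n)`) becomes a multilinear `Q` with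
`|Q| ≤ 2^(εn/3)|Γ|`, then a syntactically multilinear `P` with `|P| ≤ 2^(εn/3)|Q|`, and R gives
`2^((1-ε/3)n) ≤ |P|`; since `2^((1-ε/3)n) = 2^((1-ε)n) · 2^(εn/3) · 2^(εn/3)` (`Real.rpow_add`), dividing
by the positive factor gives `2^((1-ε)n) ≤ |Γ| = L(per_n)`.  All three stubs are load-bearing.
Conversely X ⇒ R (`RyserToMultilinear`, `complexity ≤ P.size`), and X ⇒ S, T with the witness "Ryser's
formula as a syntactically multilinear fan-in-two circuit of `≤ n² 2^n` gates" once `2^(εn)|Γ| ≥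
2^((1+ε/2)n) ≥ n² 2^n` — so the split loses nothing: X ⟺ R ∧ S ∧ T.

Disproof used: no `Disproof.lean` is registered for this crux (`ledger crux ls stmt-ValiantsHypothesis-7159`:
no workfiles before this one).  The in-tree CONDITIONAL refutation
`Literature.Computability.AlgebraicComplexity.not_ryserOptimal_of_minimalAsymptoticRank`
(TripartitionExponentPermanent.lean; hypotheses: the named facts `bkkn2025_thm_1_3`, `bkkn2025_thm_3_3`
and minimal asymptotic rank of `tripartitionTensor ℂ n`, i.e. Strassen's asymptotic rank conjecture on
the tripartition family) is honoured, not evaded: R ∧ S ∧ T ⇒ X ⇒ ¬(ARC on `P_ℕ`), and by the route's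
`HostageGlue` the tension is carried by stub R (the route's staffed crux 11285), exactly where the route
already stakes it; S and T are ARC-neutral (consistent with `per ∈ VP`).  The summit's negatives index
(4 refuted statements: affine determinantal representations / elusive candidates) is unrelated.

BC3 audit (registering seat planner-skel-stmt-ValiantsHypothesis-7159-0, 2026-08-17): see `Lines/birth.md`
(`lean check --json` rc 0, sorries = the three `stub_*` only; probes `stub → RyserOptimal`,
`stub → ValiantsHypothesis` all FAIL).

Shape (skeleton audit by-name rule, as `Cruxes/RyserOptimalDepth3/Lines/birth.lean`): §1 the stub
statements as named Props `Sig.stub_*` · §2 the registered sorried stubs `stub_*` with the statements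
spelled out (`sorry` lives only there) · §3 `RyserOptimal_of` (hypotheses = the `Sig` Props, conclusion
= the route decl BY NAME) and the hypothesis-free `RyserOptimal_proof` (the compiler checks that the
`Sig` copies and the stub statements agree).
-/

set_option linter.dupNamespace false

namespace Summit.ValiantsHypothesis.ValiantsHypothesis.Cruxes.RyserOptimal.Birth

open Literature.Computability.AlgebraicComplexity
open Summit.ValiantsHypothesis.ValiantsHypothesis.Theses.RyserTripartition
open scoped BigOperators

/-! ## §1 The stub statements as named propositions -/

namespace Sig

/-- **Stub R** — Ryser is optimal among SYNTACTICALLY MULTILINEAR fan-in-two circuits: the route's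
rank-3 crux `MultilinearRyserOptimal` (stmt-ValiantsHypothesis-11285), by name. -/
def stub_multilinearRyser : Prop :=
  MultilinearRyserOptimal

/-- **Stub S** — semantic multilinearisation of permanent circuits at sub-exponential cost: for every
`ε > 0` and large `n`, a fan-in-two circuit `Γ` computing `per_n` yields a fan-in-two circuit all of whose
gate values are multilinear (degree `≤ 1` in every variable), computing `per_n`, of size
`≤ 2^(ε n) · |Γ|`. -/
def stub_semanticMultilinearization : Prop :=
  ∀ ε : ℝ, 0 < ε → ∃ n₀ : ℕ, ∀ n ≥ n₀,
    ∀ Γ : ArithCircuit ℂ (Fin n × Fin n),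
      Γ.IsFanInTwo ∧ Γ.Computes (perPoly (Fin n) ℂ) →
        ∃ Q : ArithCircuit ℂ (Fin n × Fin n),
          Q.IsFanInTwo ∧
            (∀ v ∈ ArithCircuit.gateValues Q.gates, ∀ i : Fin n × Fin n,
                MvPolynomial.degreeOf i v ≤ 1) ∧
              Q.Computes (perPoly (Fin n) ℂ) ∧
                (Q.size : ℝ) ≤ (2 : ℝ) ^ (ε * (n : ℝ)) * (Γ.size : ℝ)

/-- **Stub T** — syntactic from semantic at sub-exponential cost: for every `ε > 0` and large `n`, a
fan-in-two MULTILINEAR circuit `Γ` computing `per_n` yields a fan-in-two SYNTACTICALLY MULTILINEAR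
circuit computing `per_n` of size `≤ 2^(ε n) · |Γ|`. -/
def stub_syntacticMultilinearization : Prop :=
  ∀ ε : ℝ, 0 < ε → ∃ n₀ : ℕ, ∀ n ≥ n₀,
    ∀ Γ : ArithCircuit ℂ (Fin n × Fin n),
      Γ.IsFanInTwo ∧
          (∀ v ∈ ArithCircuit.gateValues Γ.gates, ∀ i : Fin n × Fin n,
              MvPolynomial.degreeOf i v ≤ 1) ∧
            Γ.Computes (perPoly (Fin n) ℂ) →
        ∃ P : ArithCircuit ℂ (Fin n × Fin n),
          P.IsFanInTwo ∧ IsSyntacticallyMultilinear P ∧ P.Computes (perPoly (Fin n) ℂ) ∧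
            (P.size : ℝ) ≤ (2 : ℝ) ^ (ε * (n : ℝ)) * (Γ.size : ℝ)

end Sig

/-! ## §2 The registered stubs (statements spelled out; `sorry` lives only here) -/

/-- **Stub R (registered)** — MULTILINEAR RYSER-OPTIMALITY = the route crux `MultilinearRyserOptimal`
(stmt-ValiantsHypothesis-11285): for every `ε > 0` and all large `n`, every fan-in-two syntactically
multilinear circuit over `ℂ` computing `per_n` has `≥ 2^((1-ε) n)` gates.  Open (conjecture-grade); the
known technology (partial-derivative matrix under random partitions) gives `n^{Ω(log n)}` for
multilinear formulas and `Ω(n^{4/3}/log² n)` / `Ω(n²/log² n)` for syntactically multilinear circuits.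
[cite: RazYehudayoff2008, §2] [cite: doi:10.1137/070707932] [cite: AlonKumarVolk2020, Thm. 1] -/
theorem stub_multilinearRyser : MultilinearRyserOptimal := by
  sorry

/-- **Stub S (registered)** — SEMANTIC MULTILINEARISATION AT SUB-EXPONENTIAL COST: for every `ε > 0`
there is `n₀` such that for all `n ≥ n₀`, every fan-in-two circuit `Γ` over `ℂ` computing `per_n` yields
a fan-in-two circuit `Q` computing `per_n`, every gate value of which has degree `≤ 1` in each variable
(a multilinear circuit in the sense of Raz–Yehudayoff), with `|Q| ≤ 2^(ε n) · |Γ|`.  Open.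
[cite: doi:10.1016/j.jcss.2010.06.013, §1.1 (multilinear vs. syntactically multilinear circuits)] -/
theorem stub_semanticMultilinearization :
    ∀ ε : ℝ, 0 < ε → ∃ n₀ : ℕ, ∀ n ≥ n₀,
      ∀ Γ : ArithCircuit ℂ (Fin n × Fin n),
        Γ.IsFanInTwo ∧ Γ.Computes (perPoly (Fin n) ℂ) →
          ∃ Q : ArithCircuit ℂ (Fin n × Fin n),
            Q.IsFanInTwo ∧
              (∀ v ∈ ArithCircuit.gateValues Q.gates, ∀ i : Fin n × Fin n,
                  MvPolynomial.degreeOf i v ≤ 1) ∧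
                Q.Computes (perPoly (Fin n) ℂ) ∧
                  (Q.size : ℝ) ≤ (2 : ℝ) ^ (ε * (n : ℝ)) * (Γ.size : ℝ) := by
  sorry

/-- **Stub T (registered)** — SYNTACTIC FROM SEMANTIC AT SUB-EXPONENTIAL COST: for every `ε > 0` there
is `n₀` such that for all `n ≥ n₀`, every fan-in-two multilinear circuit `Γ` over `ℂ` computing `per_n`
(all gate values of degree `≤ 1` in each variable) yields a fan-in-two SYNTACTICALLY multilinear circuit
`P` computing `per_n` with `|P| ≤ 2^(ε n) · |Γ|`.  Free for formulas (Raz), open for circuits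
(Raz–Shpilka–Yehudayoff 2008).
[cite: doi:10.1137/070707932] [cite: doi:10.1016/j.jcss.2010.06.013, §1.1] -/
theorem stub_syntacticMultilinearization :
    ∀ ε : ℝ, 0 < ε → ∃ n₀ : ℕ, ∀ n ≥ n₀,
      ∀ Γ : ArithCircuit ℂ (Fin n × Fin n),
        Γ.IsFanInTwo ∧
            (∀ v ∈ ArithCircuit.gateValues Γ.gates, ∀ i : Fin n × Fin n,
                MvPolynomial.degreeOf i v ≤ 1) ∧
              Γ.Computes (perPoly (Fin n) ℂ) →
          ∃ P : ArithCircuit ℂ (Fin n × Fin n),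
            P.IsFanInTwo ∧ IsSyntacticallyMultilinear P ∧ P.Computes (perPoly (Fin n) ℂ) ∧
              (P.size : ℝ) ≤ (2 : ℝ) ^ (ε * (n : ℝ)) * (Γ.size : ℝ) := by
  sorry

/-! ## §3 Composition (sorry-free) -/

/-- **The line closes the crux**: multilinear Ryser-optimality (R) + semantic multilinearisation (S) +
syntactification (T) give `RyserTripartition.RyserOptimal` BY NAME.  Each of S, T, R is run at `ε/3`;
an optimal circuit for `per_n` (`exists_computes_size_eq_complexity`) is pushed through S and T and
measured by R, and `2^((1-ε/3) n) = 2^((1-ε) n) · 2^(ε n/3) · 2^(ε n/3)` finishes. -/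
theorem RyserOptimal_of :
    Sig.stub_multilinearRyser → Sig.stub_semanticMultilinearization →
      Sig.stub_syntacticMultilinearization →
        Summit.ValiantsHypothesis.ValiantsHypothesis.Theses.RyserTripartition.RyserOptimal := by
  intro hR hS hT ε hε
  have hε3 : 0 < ε / 3 := by positivity
  obtain ⟨n₁, h₁⟩ := hR (ε / 3) hε3
  obtain ⟨n₂, h₂⟩ := hS (ε / 3) hε3
  obtain ⟨n₃, h₃⟩ := hT (ε / 3) hε3
  refine ⟨max n₁ (max n₂ n₃), fun n hn => ?_⟩
  have hn₁ : n ≥ n₁ := le_trans (le_max_left _ _) hn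
  have hn₂ : n ≥ n₂ := le_trans ((le_max_left _ _).trans (le_max_right _ _)) hn
  have hn₃ : n ≥ n₃ := le_trans ((le_max_right _ _).trans (le_max_right _ _)) hn
  -- an optimal fan-in-two circuit for `per_n`
  obtain ⟨Γ, hΓ2, hΓc, hΓs⟩ :=
    ArithCircuit.exists_computes_size_eq_complexity (perPoly (Fin n) ℂ)
  -- S: multilinearise, T: syntactify, R: measure
  obtain ⟨Q, hQ2, hQm, hQc, hQs⟩ := h₂ n hn₂ Γ ⟨hΓ2, hΓc⟩
  obtain ⟨P, hP2, hPm, hPc, hPs⟩ := h₃ n hn₃ Q ⟨hQ2, hQm, hQc⟩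
  have hlow : (2 : ℝ) ^ ((1 - ε / 3) * (n : ℝ)) ≤ (P.size : ℝ) := h₁ n hn₁ P ⟨hP2, hPm, hPc⟩
  -- arithmetic: 2^((1-ε/3)n) = 2^((1-ε)n) · (2^(εn/3) · 2^(εn/3))
  have two_pos : (0 : ℝ) < 2 := two_pos
  have hA : 0 < (2 : ℝ) ^ (ε / 3 * (n : ℝ)) := Real.rpow_pos_of_pos two_pos _
  have hsplit : (2 : ℝ) ^ ((1 - ε / 3) * (n : ℝ)) =
      (2 : ℝ) ^ ((1 - ε) * (n : ℝ)) * ((2 : ℝ) ^ (ε / 3 * (n : ℝ)) * (2 : ℝ) ^ (ε / 3 * (n : ℝ))) := by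
    rw [← Real.rpow_add two_pos, ← Real.rpow_add two_pos]; ring_nf
  have hchain : (2 : ℝ) ^ ((1 - ε) * (n : ℝ)) * ((2 : ℝ) ^ (ε / 3 * (n : ℝ)) * (2 : ℝ) ^ (ε / 3 * (n : ℝ)))
      ≤ (Γ.size : ℝ) * ((2 : ℝ) ^ (ε / 3 * (n : ℝ)) * (2 : ℝ) ^ (ε / 3 * (n : ℝ))) := by
    calc (2 : ℝ) ^ ((1 - ε) * (n : ℝ)) * ((2 : ℝ) ^ (ε / 3 * (n : ℝ)) * (2 : ℝ) ^ (ε / 3 * (n : ℝ)))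
        = (2 : ℝ) ^ ((1 - ε / 3) * (n : ℝ)) := hsplit.symm
      _ ≤ (P.size : ℝ) := hlow
      _ ≤ (2 : ℝ) ^ (ε / 3 * (n : ℝ)) * (Q.size : ℝ) := hPs
      _ ≤ (2 : ℝ) ^ (ε / 3 * (n : ℝ)) * ((2 : ℝ) ^ (ε / 3 * (n : ℝ)) * (Γ.size : ℝ)) :=
          mul_le_mul_of_nonneg_left hQs hA.le
      _ = (Γ.size : ℝ) * ((2 : ℝ) ^ (ε / 3 * (n : ℝ)) * (2 : ℝ) ^ (ε / 3 * (n : ℝ))) := by ring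
  have hfinal : (2 : ℝ) ^ ((1 - ε) * (n : ℝ)) ≤ (Γ.size : ℝ) :=
    le_of_mul_le_mul_right hchain (mul_pos hA hA)
  rw [hΓs] at hfinal
  exact hfinal

/-- THE SKELETON: the crux, modulo exactly the three registered stubs (the compiler checks that the
`Sig` copies and the stub statements agree). -/
theorem RyserOptimal_proof :
    Summit.ValiantsHypothesis.ValiantsHypothesis.Theses.RyserTripartition.RyserOptimal :=
  RyserOptimal_of stub_multilinearRyser stub_semanticMultilinearization
    stub_syntacticMultilinearization

end Summit.ValiantsHypothesis.ValiantsHypothesis.Cruxes.RyserOptimal.Birth
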